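import Mathlib.Analysis.SpecialFunctions.Pow.Real
import Mathlib.Analysis.SpecialFunctions.Complex.Log
import Mathlib.LinearAlgebra.LinearIndependent.Lemmas
import Mathlib.LinearAlgebra.Complex.Module
import Mathlib.RingTheory.Algebraic.Basic
import Literature.AlgebraicGeometry.Frobenioids.LogPrimesTranscendence
import Literature.NumberTheory.Transcendental.SixExponentialsProofs
import HarnessLib

/-!
# Frobenioids I, Lemma 6.5 (ii) — PROOF (from the six exponentials theorem)

Mochizuki, *The geometry of Frobenioids I*, kurims pp. 116–117: "(ii) Let `p₁, …, p₆` be distinct prime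
numbers. Then there do not exist `λ₁, λ₂ ∈ ℚ_{>0}` such that:
`log(p₁)/log(p₂) = λ₁·log(p₃)/log(p₄) = λ₂·log(p₅)/log(p₆)`", proved there from "a theorem of Lang
[Lang1]; [Baker] p. 119" — the six exponentials theorem — applied to the `ℚ`-linearly independent sets
`{log p₂, log p₄, log p₆}` and `{1, log p₃/log p₄}`, all six of whose pairwise products have algebraic
exponentials (`p₂, p₄, p₆, p₁^{1/λ₁}, p₃, p₅^{λ₂/λ₁}`). [cite: MochizukiFrdI2008, Lem. 6.5 (ii) p.116]

DISCHARGED here, sorry-free, from the tree's PROVED six exponentials theorem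
(`Literature.NumberTheory.Transcendental.six_exponentials_holds`, Lang 1966 Ch. II §1 Thm. 1) and
abc-iut-L1-t3's Lemma 6.5 (i) (`linearIndependent_rat_log_primes`). Indices are 0-based as typed:
`log p₀/log p₁ = λ₁·log p₂/log p₃ = λ₂·log p₄/log p₅`.
-/

noncomputable section

namespace Literature.AlgebraicGeometry.Frobenioids

open Literature.NumberTheory.Transcendental

namespace Lemma65ii

/-- `exp(q · log n)` is algebraic for `q ∈ ℚ`, `n ≥ 1`: its `den(q)`-th power is `n^{num(q)}`.
[cite: MochizukiFrdI2008, Lem. 6.5 (ii) p.117] -/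
theorem isAlgebraic_exp_rat_mul_log (q : ℚ) {n : ℕ} (hn : 0 < n) :
    IsAlgebraic ℚ (Real.exp ((q : ℝ) * Real.log n)) := by
  have hn' : (0 : ℝ) < n := by exact_mod_cast hn
  refine IsAlgebraic.of_pow q.den_pos ?_
  have key : Real.exp ((q : ℝ) * Real.log n) ^ q.den = (((n : ℚ) ^ q.num : ℚ) : ℝ) := by
    rw [← Real.exp_nat_mul, ← mul_assoc]
    have hq : (q.den : ℝ) * (q : ℝ) = (q.num : ℝ) := by
      rw [mul_comm]
      exact_mod_cast Rat.mul_den_eq_num q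
    rw [hq, mul_comm, ← Real.rpow_def_of_pos hn', Real.rpow_intCast]
    push_cast
    rfl
  rw [key]
  exact isAlgebraic_algebraMap _

/-- The logarithms of distinct primes, re-indexed along an injection, are `ℚ`-linearly independent
(Lemma 6.5 (i), abc-iut-L1-t3). [cite: MochizukiFrdI2008, Lem. 6.5 (i) p.116] -/
theorem linearIndependent_log_comp {ι : Type*} (f : ι → Nat.Primes) (hf : Function.Injective f) :
    LinearIndependent ℚ fun i => Real.log (f i : ℕ) :=
  linearIndependent_rat_log_primes.comp f hf

/-- Real vectors that are `ℚ`-linearly independent stay so in `ℂ`. [cite: MochizukiFrdI2008, Lem. 6.5 (ii) p.117] -/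
theorem linearIndependent_ofReal {ι : Type*} {v : ι → ℝ} (hv : LinearIndependent ℚ v) :
    LinearIndependent ℚ fun i => (v i : ℂ) := by
  apply LinearIndependent.of_comp (Complex.reLm.restrictScalars ℚ)
  have : (⇑(Complex.reLm.restrictScalars ℚ) ∘ fun i => (v i : ℂ)) = v := by
    funext i
    simp
  rw [this]
  exact hv

end Lemma65ii

open Lemma65ii in
/-- **Lemma 6.5 (ii)** — PROVED (the named statement `Lemma65ii` of abc-iut-L1-t3 holds): for distinct
primes `p₀, …, p₅` there are no `λ₁, λ₂ ∈ ℚ_{>0}` with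
`log p₀/log p₁ = λ₁·log p₂/log p₃ = λ₂·log p₄/log p₅`. Mochizuki's reduction (FrdI p. 117) to the six
exponentials theorem with `x = (1, log p₂/log p₃)`, `y = (log p₁, log p₃, log p₅)`: the six numbers
`exp(xᵢyⱼ)` are `p₁, p₃, p₅, p₀^{1/λ₁}, p₂, p₄^{λ₂/λ₁}`, all algebraic.
[cite: MochizukiFrdI2008, Lem. 6.5 (ii) p.116] -/
theorem Lemma65ii_holds : Lemma65ii := by
  intro p hp
  rintro ⟨l₁, l₂, hl₁, hl₂, h1, h2⟩
  have hpos : ∀ i, 0 < ((p i : ℕ)) := fun i => (p i).2.pos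
  have hlog : ∀ i, Real.log (p i : ℕ) ≠ 0 := fun i =>
    (Real.log_pos (by exact_mod_cast (p i).2.one_lt)).ne'
  have hl₁' : (l₁ : ℝ) ≠ 0 := by exact_mod_cast hl₁.ne'
  -- abbreviations
  set A := Real.log (p 0 : ℕ) with hA
  set B := Real.log (p 1 : ℕ) with hB
  set C := Real.log (p 2 : ℕ) with hC
  set D := Real.log (p 3 : ℕ) with hD
  set G := Real.log (p 4 : ℕ) with hG
  set E := Real.log (p 5 : ℕ) with hE
  have hB0 : B ≠ 0 := hlog 1
  have hD0 : D ≠ 0 := hlog 3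
  have hE0 : E ≠ 0 := hlog 5
  -- the two key consequences of the hypotheses
  have e10 : C / D * B = ((l₁⁻¹ : ℚ) : ℝ) * A := by
    push_cast
    field_simp
    field_simp at h1
    linarith [h1]
  have e12 : C / D * E = ((l₂ / l₁ : ℚ) : ℝ) * G := by
    push_cast
    field_simp
    field_simp at h2
    linarith [h2]
  -- Mochizuki's vectors
  let xr : Fin 2 → ℝ := ![1, C / D]
  let yr : Fin 3 → ℝ := ![B, D, E]
  -- linear independence over ℚ
  have hg : Function.Injective (![1, 3, 5] : Fin 3 → Fin 6) := by decide
  have hy : LinearIndependent ℚ yr := by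
    have := linearIndependent_log_comp (p ∘ ![1, 3, 5]) (hp.comp hg)
    convert this using 1
    funext j
    fin_cases j <;> rfl
  have hCD : LinearIndependent ℚ ![D, C] := by
    have hg' : Function.Injective (![3, 2] : Fin 2 → Fin 6) := by decide
    have := linearIndependent_log_comp (p ∘ ![3, 2]) (hp.comp hg')
    convert this using 1
    funext j
    fin_cases j <;> rfl
  have hx : LinearIndependent ℚ xr := by
    rw [LinearIndependent.pair_iff]
    intro s t hst
    rw [LinearIndependent.pair_iff] at hCD
    have hst' : s • D + t • C = 0 := by
      rw [Rat.smul_def, Rat.smul_def] at hst ⊢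
      have := congrArg (· * D) hst
      simp only [zero_mul, add_mul] at this
      rw [mul_one] at this
      calc (s : ℝ) * D + t * C = s * D + t * (C / D) * D := by field_simp
        _ = 0 := this
    exact hCD s t hst'
  -- all six exponentials are algebraic
  have halg : ∀ i j, IsAlgebraic ℚ (Real.exp (xr i * yr j)) := by
    intro i j
    fin_cases i <;> fin_cases j
    · show IsAlgebraic ℚ (Real.exp (1 * B))
      rw [one_mul, hB, Real.exp_log (by exact_mod_cast hpos 1)]
      exact isAlgebraic_nat _
    · show IsAlgebraic ℚ (Real.exp (1 * D))
      rw [one_mul, hD, Real.exp_log (by exact_mod_cast hpos 3)]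
      exact isAlgebraic_nat _
    · show IsAlgebraic ℚ (Real.exp (1 * E))
      rw [one_mul, hE, Real.exp_log (by exact_mod_cast hpos 5)]
      exact isAlgebraic_nat _
    · show IsAlgebraic ℚ (Real.exp (C / D * B))
      rw [e10, hA]
      exact isAlgebraic_exp_rat_mul_log _ (hpos 0)
    · show IsAlgebraic ℚ (Real.exp (C / D * D))
      rw [div_mul_cancel₀ C hD0, hC, Real.exp_log (by exact_mod_cast hpos 2)]
      exact isAlgebraic_nat _
    · show IsAlgebraic ℚ (Real.exp (C / D * E))
      rw [e12, hG]
      exact isAlgebraic_exp_rat_mul_log _ (hpos 4)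
  -- the six exponentials theorem
  obtain ⟨i, j, htr⟩ := six_exponentials_holds (fun i => (xr i : ℂ)) (fun j => (yr j : ℂ))
    (linearIndependent_ofReal hx) (linearIndependent_ofReal hy)
  apply htr
  rw [← Complex.ofReal_mul, ← Complex.ofReal_exp]
  exact (halg i j).algebraMap

end Literature.AlgebraicGeometry.Frobenioids

end
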